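import Mathlib

/-!
# King 1986, (4.22): the alias sums `Σ_{l,m} |p′+l+m|^{α−1} Π_μ |p′_μ||(p′+l+m)_μ|^{−1} ≤ C` converge in every
# dimension for `α < 1` — kernel form with an explicit constant

**Citation header (reproduction of PUBLISHED work; template file of the Bałaban lattice Yang–Mills cell `pub-balaban`,
TEMPLATE.md §18.2 caveat (e) "the alias sums (4.22) … converge in every d by inspection — NOT re-derived here";
companion of the `King1986/*` modules).**  C. King, *The U(1) Higgs model. I. The continuum limit*, Commun. Math.
Phys. **102** (1986) 649–677 [King1986], §4 p. 672: (4.19)–(4.23).  Page image read: cell folder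
`b2b-balaban-template/king-renders/1986-cmp102-king-u1-higgs-I-p024-x2.png` (p. 672).  King's paper is TEMPLATE
LITERATURE for the cell (a printed and proved `A = 0` mechanism), not a manuscript under audit.

**What King prints (verbatim, p. 672).**  After (4.19): *"where l ∈ 2πZ^d is the same as in (4.2). Also m ∈ 2πL^kZ^d
and |m_μ| ≤ πL^k(L^n − 1) for L odd, while m ∈ 2π(L^k + 1)Z^d and |m_μ| ≤ π(L^k + 1)(L^n − 1) for L even. … We have the
following bounds:  |u^{η′}_{k+n}(p′+l+m)| < C Π_{μ=1}^d |p′_μ| |(p′+l+m)_μ|^{−1}, (4.20)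
|Δ^{(k+n)}(p′)Δ^{η′}(p′+l+m)^{−1}| ≤ C|p′|² |p′+l+m|^{−2}. (4.21)  Also  (η′)^{−1}|exp[iη′(p′+l+m)_μ] − 1| ≤ C|(p′+l+m)_μ|
and  |x′ − y′|^{−α}|1 − exp[i(p′+l+m)(y′−x′)]| ≤ C|p′+l+m|^α,  so the sum over l, m is bounded by
Σ_{l,m} |p′+l+m|^{α−1} Π_μ |(p′+l+m)_μ|^{−1} ≤ C  for  α < 1. (4.22)  We first bound the terms in (4.19) with m ≠ 0 as
follows:  |(4.19); m ≠ 0| ≤ C(2π)^{−d}∫dp′ Σ_{m≠0} Σ_l |p′+l+m|^{α−1}|p′|² Π_μ |p′_μ||(p′+l+m)_μ|^{−1}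
≤ CL^{−γk}(2π)^{−d}∫dp′ Σ_{m≠0} Σ_l |p′+l+m|^{α−1+γ}|p′|² Π_μ |p′_μ| |(p′+l+m)_μ|^{−1} ≤ CL^{−γk}  for  α + γ < 1. (4.23)"*

**Located reading note (record only, not an objection to King's proof).**  As displayed, the left side of (4.22)
WITHOUT the factors `|p′_μ|` of (4.20) is not bounded uniformly in `p′` (for `d ≥ 2` and an alias `l + m` with a
vanishing coordinate, `|(p′+l+m)_μ|^{−1} = |p′_μ|^{−1}` is unbounded); King uses (4.22) only inside (4.23), where the
`Π_μ|p′_μ|` of (4.20) is present, and there the product `Π_μ |p′_μ||(p′+l+m)_μ|^{−1}` is `≤` the product over the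
ACTIVE coordinates (those with `(l+m)_μ ≠ 0`).  This file proves the bound in that form — the one actually used — and
with the `(l, m) = (0, 0)` alias excluded (it is King's main term, treated separately in (4.24)–(4.28); in (4.23) it is
absent because `m ≠ 0`).

**What this file PROVES (kernel, Mathlib only; explicit constants; sup norm `‖q‖ = max_μ|q_μ|` on `ℝ^d`, which only
ENLARGES `|q|^{α−1}` relative to the Euclidean norm since `α − 1 < 0`).**
* §1 the integral test with explicit constant: `Σ_{n<N} (n+1)^{−s} ≤ s/(s−1)` for `s > 1` (`sum_range_rpow_neg_le`,
  via Mathlib `AntitoneOn.sum_le_integral` and `integral_rpow`).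
* §2 one coordinate: for `|p| ≤ π` and an integer `i ≠ 0`, `|p + 2πi| ≥ π|i|` (`pi_mul_abs_le_abs_add`); the majorant
  `aliasMaj s p i = π|p + 2πi|^{−s}` (`i ≠ 0`), `= 1` (`i = 0`) has `Σ_{|i|≤N} aliasMaj s p i ≤ 1 + 2π^{1−s}s/(s−1)`
  uniformly in `N`, `p` (`sum_aliasMaj_le`).
* §3 **(4.22)**: with `aliasTerm α p′ j = ‖p′ + 2πj‖^{α−1} · Π_μ [j_μ = 0 ? 1 : |p′_μ|/|p′_μ + 2πj_μ|]`
  (`aliasWeight`), the TERMWISE FACTORISATION `aliasTerm α p′ j ≤ Π_μ aliasMaj s p′_μ j_μ` for `j ≠ 0`,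
  `s = 1 + (1−α)/d` (`aliasTerm_le_prod_aliasMaj`: `‖q‖^{α−1} = Π_μ‖q‖^{(α−1)/d}`, `‖q‖ ≥ |q_μ|` on active and
  `‖q‖ ≥ 1` on inactive coordinates — King's "by inspection"), hence by the product formula for box sums
  **`alias_sum_le`**: `Σ_{j ∈ [−N,N]^d, j ≠ 0} aliasTerm α p′ j ≤ C(d, α)` and **`alias_sum_le_of_subset`**: the same
  for ANY finite family of nonzero integer vectors, uniformly in `p′ ∈ [−π, π]^d`, with
  `C(d, α) = aliasConst d α = (1 + 2π^{−(1−α)/d}(1 + (1−α)/d)·d/(1−α))^d − 1` (for `d ≥ 1`, `α < 1`).  With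
  `α ↦ α + γ` this is the constant of (4.23) (`α + γ < 1`).
* §4 King's indexation: `(a, b) ↦ a + M b` is injective for `2|a_μ| < M` (`digits_injective`, `digits_injective_pi`),
  so the double sum over `l = 2πa` (`|l_μ| ≤ π(L^k − 1)`, i.e. `2|a_μ| ≤ L^k − 1 < L^k = M`) and `m = 2πL^k b` in
  (4.22)/(4.23) is a sum over DISTINCT aliases `p′ + 2π(a + L^k b)` and is bounded by `alias_sum_le_of_subset`.

**NOT COVERED.**  (4.19)–(4.21) themselves (the Fourier representation and the factor bounds), the `p′`-integral and
the `L^{−γk}` extraction of (4.23), (4.24)–(4.28), Prop. 3.9; `A ≠ 0`; King's even-`L` variant of the `m`-lattice is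
covered by §3 (any finite family of distinct nonzero aliases) but its injectivity bookkeeping is not spelled out.

**How the cell uses this (pointer, not a ruling).**  Closes TEMPLATE §18.2 caveat (e) for the record: the
dimension-dependence of King's §4 alias sums is harmless in every `d` (the exponent margin is `(1−α)/d` per active
coordinate, constant `C(d, α)` above), so nothing in the `A = 0` K3 mechanism is tied to `d ≤ 3` at this point; the
`d`-dependence that matters is in the exponents `(L^jη)^{2−d−γ}` of K4 and in power counting, not here.  No
`def … : Prop` is introduced (D-0026).  Value = kernel reproduction of a printed `A = 0` estimate with an explicit
constant, NOT summit progress.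
-/

noncomputable section

open Real Finset

namespace Literature.MathematicalPhysics.QuantumFieldTheory.King1986

/-! ## §1  The one-dimensional sum `Σ_{n=1}^{N} n^{-s} ≤ s/(s−1)` for `s > 1` -/

/-- Integral comparison: `Σ_{i<K} (i+2)^{-s} ≤ ∫_1^{1+K} x^{-s} dx ≤ 1/(s−1)` for `s > 1`. [folklore] -/
theorem sum_range_rpow_neg_le_aux {s : ℝ} (hs : 1 < s) (K : ℕ) :
    ∑ i ∈ Finset.range K, ((i : ℝ) + 2) ^ (-s) ≤ 1 / (s - 1) := by
  have hanti : AntitoneOn (fun x : ℝ => x ^ (-s)) (Set.Icc (1 : ℝ) (1 + K)) := by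
    intro x hx y hy hxy
    exact rpow_le_rpow_of_nonpos (by linarith [hx.1]) hxy (by linarith)
  have h1 := AntitoneOn.sum_le_integral hanti
  have heq : ∑ i ∈ Finset.range K, ((i : ℝ) + 2) ^ (-s) =
      ∑ i ∈ Finset.range K, ((1 : ℝ) + ((i + 1 : ℕ) : ℝ)) ^ (-s) :=
    Finset.sum_congr rfl fun i _ => by push_cast; congr 1; ring
  have hint : ∫ x in (1 : ℝ)..(1 + K), x ^ (-s) = ((1 + K : ℝ) ^ (-s + 1) - 1 ^ (-s + 1)) / (-s + 1) := by
    apply integral_rpow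
    right
    refine ⟨by linarith, ?_⟩
    rw [Set.uIcc_of_le (by linarith [(Nat.cast_nonneg K : (0 : ℝ) ≤ K)] : (1 : ℝ) ≤ 1 + K)]
    intro h
    exact absurd h.1 (by norm_num)
  have hN0 : (0 : ℝ) ≤ (1 + K : ℝ) ^ (-s + 1) := rpow_nonneg (by positivity) _
  calc ∑ i ∈ Finset.range K, ((i : ℝ) + 2) ^ (-s)
      = ∑ i ∈ Finset.range K, ((1 : ℝ) + ((i + 1 : ℕ) : ℝ)) ^ (-s) := heq
    _ ≤ ∫ x in (1 : ℝ)..(1 + K), x ^ (-s) := h1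
    _ = ((1 + K : ℝ) ^ (-s + 1) - 1) / (-s + 1) := by rw [hint, one_rpow]
    _ = (1 - (1 + K : ℝ) ^ (-s + 1)) / (s - 1) := by
        rw [← neg_div_neg_eq]; ring_nf
    _ ≤ 1 / (s - 1) := by
        apply div_le_div_of_nonneg_right _ (by linarith)
        linarith

/-- `Σ_{n<N} (n+1)^{-s} ≤ s/(s−1)` for `s > 1` (the term `n = 0` is `1`, the rest by the integral test). [folklore] -/
theorem sum_range_rpow_neg_le {s : ℝ} (hs : 1 < s) (N : ℕ) :
    ∑ n ∈ Finset.range N, ((n : ℝ) + 1) ^ (-s) ≤ s / (s - 1) := by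
  have hne : s - 1 ≠ 0 := (by linarith : (0 : ℝ) < s - 1).ne'
  have hs1 : s / (s - 1) = 1 + 1 / (s - 1) := by field_simp; ring
  cases N with
  | zero =>
    simp only [Finset.range_zero, Finset.sum_empty]
    exact div_nonneg (by linarith) (by linarith)
  | succ K =>
    rw [Finset.sum_range_succ', hs1]
    have heq : ∑ n ∈ Finset.range K, (((n + 1 : ℕ) : ℝ) + 1) ^ (-s) =
        ∑ n ∈ Finset.range K, ((n : ℝ) + 2) ^ (-s) :=
      Finset.sum_congr rfl fun n _ => by push_cast; congr 1; ring
    have h0 : (((0 : ℕ) : ℝ) + 1) ^ (-s) = 1 := by simp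
    rw [heq, h0]
    linarith [sum_range_rpow_neg_le_aux hs K]

/-! ## §2  One coordinate: the alias majorant `g(i) = π |p + 2πi|^{-s}` (`i ≠ 0`), `g(0) = 1` -/

/-- Distance of `p + 2πi` from `0` for `|p| ≤ π`, `i ≠ 0` an integer: at least `π|i|` (indeed `≥ π(2|i| − 1)`).
[folklore] -/
theorem pi_mul_abs_le_abs_add {p : ℝ} (hp : |p| ≤ π) {i : ℤ} (hi : i ≠ 0) :
    π * |(i : ℝ)| ≤ |p + 2 * π * i| := by
  have hi1 : (1 : ℝ) ≤ |(i : ℝ)| := by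
    rw [← Int.cast_abs]; exact_mod_cast Int.one_le_abs hi
  have h1 : |2 * π * (i : ℝ)| - |p| ≤ |p + 2 * π * i| := by
    have := abs_sub_abs_le_abs_sub (2 * π * (i : ℝ)) (-p)
    rw [abs_neg, sub_neg_eq_add, add_comm] at this
    exact this
  rw [abs_mul, abs_of_pos (by positivity : (0 : ℝ) < 2 * π)] at h1
  nlinarith [Real.pi_pos]

/-- Lower bound `π ≤ |p + 2πi|` for `|p| ≤ π`, `i ≠ 0`. [folklore] -/
theorem pi_le_abs_add {p : ℝ} (hp : |p| ≤ π) {i : ℤ} (hi : i ≠ 0) : π ≤ |p + 2 * π * i| := by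
  have hi1 : (1 : ℝ) ≤ |(i : ℝ)| := by
    rw [← Int.cast_abs]; exact_mod_cast Int.one_le_abs hi
  have h := pi_mul_abs_le_abs_add hp hi
  nlinarith [Real.pi_pos]

/-- The one-coordinate majorant: `aliasMaj s p i = π · |p + 2πi|^{-s}` for `i ≠ 0` and `1` for `i = 0`.
[cite: King1986, (4.20)–(4.22) p.672] -/
def aliasMaj (s p : ℝ) (i : ℤ) : ℝ := if i = 0 then 1 else π * |p + 2 * π * i| ^ (-s)

/-- `aliasMaj` is nonnegative. [folklore] -/
theorem aliasMaj_nonneg (s p : ℝ) (i : ℤ) : 0 ≤ aliasMaj s p i := by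
  unfold aliasMaj
  split_ifs
  · exact zero_le_one
  · exact mul_nonneg Real.pi_pos.le (rpow_nonneg (abs_nonneg _) _)

/-- For `i ≠ 0`, `|p| ≤ π`, `s ≥ 0`: `aliasMaj s p i ≤ π^{1−s} |i|^{-s}`. [folklore] -/
theorem aliasMaj_le {s p : ℝ} (hs : 0 ≤ s) (hp : |p| ≤ π) {i : ℤ} (hi : i ≠ 0) :
    aliasMaj s p i ≤ π ^ (1 - s) * |(i : ℝ)| ^ (-s) := by
  unfold aliasMaj
  rw [if_neg hi]
  have hi0 : (0 : ℝ) < |(i : ℝ)| := by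
    rw [← Int.cast_abs]; exact_mod_cast Int.one_le_abs hi
  have hpi : 0 < π * |(i : ℝ)| := mul_pos Real.pi_pos hi0
  have h1 : |p + 2 * π * i| ^ (-s) ≤ (π * |(i : ℝ)|) ^ (-s) :=
    rpow_le_rpow_of_nonpos hpi (pi_mul_abs_le_abs_add hp hi) (by linarith)
  calc π * |p + 2 * π * ↑i| ^ (-s) ≤ π * (π * |(i : ℝ)|) ^ (-s) :=
        mul_le_mul_of_nonneg_left h1 Real.pi_pos.le
    _ = π ^ (1 - s) * |(i : ℝ)| ^ (-s) := by
        rw [mul_rpow Real.pi_pos.le hi0.le, ← mul_assoc]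
        congr 1
        rw [show (1 - s) = 1 + (-s) by ring, rpow_add Real.pi_pos, rpow_one]

/-- Sums over the symmetric integer window `[-N, N]` split into `0` and the pairs `±(n+1)`, `n < N`. [folklore] -/
theorem sum_Icc_neg_eq (f : ℤ → ℝ) (N : ℕ) :
    ∑ i ∈ Finset.Icc (-(N : ℤ)) N, f i =
      f 0 + ∑ n ∈ Finset.range N, (f ((n : ℤ) + 1) + f (-((n : ℤ) + 1))) := by
  induction N with
  | zero => simp
  | succ N ih =>
    have hset : Finset.Icc (-((N + 1 : ℕ) : ℤ)) ((N + 1 : ℕ) : ℤ) =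
        insert ((N : ℤ) + 1) (insert (-((N : ℤ) + 1)) (Finset.Icc (-(N : ℤ)) N)) := by
      ext i
      simp only [Finset.mem_Icc, Finset.mem_insert, Nat.cast_add, Nat.cast_one]
      omega
    rw [hset, Finset.sum_insert, Finset.sum_insert, ih, Finset.sum_range_succ]
    · ring
    · simp only [Finset.mem_Icc]; omega
    · simp only [Finset.mem_insert, Finset.mem_Icc]; omega

/-- The one-coordinate sum: `Σ_{|i| ≤ N} aliasMaj s p i ≤ 1 + 2π^{1−s}·s/(s−1)` for `s > 1`, `|p| ≤ π`, uniformly in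
`N` and `p`. [cite: King1986, (4.22) p.672] -/
theorem sum_aliasMaj_le {s p : ℝ} (hs : 1 < s) (hp : |p| ≤ π) (N : ℕ) :
    ∑ i ∈ Finset.Icc (-(N : ℤ)) N, aliasMaj s p i ≤ 1 + 2 * π ^ (1 - s) * (s / (s - 1)) := by
  rw [sum_Icc_neg_eq]
  have h0 : aliasMaj s p 0 = 1 := by simp [aliasMaj]
  rw [h0]
  have hterm : ∀ n : ℕ, aliasMaj s p ((n : ℤ) + 1) + aliasMaj s p (-((n : ℤ) + 1)) ≤
      2 * π ^ (1 - s) * ((n : ℝ) + 1) ^ (-s) := by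
    intro n
    have hne : ((n : ℤ) + 1) ≠ 0 := by omega
    have hne' : (-((n : ℤ) + 1)) ≠ 0 := by omega
    have h1 := aliasMaj_le (by linarith : 0 ≤ s) hp hne
    have h2 := aliasMaj_le (by linarith : 0 ≤ s) hp hne'
    have hc : |(((n : ℤ) + 1 : ℤ) : ℝ)| = (n : ℝ) + 1 := by
      push_cast; rw [abs_of_nonneg (by positivity)]
    have hc' : |((-((n : ℤ) + 1) : ℤ) : ℝ)| = (n : ℝ) + 1 := by
      push_cast; rw [abs_neg, abs_of_nonneg (by positivity)]
    rw [hc] at h1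
    rw [hc'] at h2
    linarith
  have hsum := Finset.sum_le_sum fun n (_ : n ∈ Finset.range N) => hterm n
  rw [← Finset.mul_sum] at hsum
  have hS := sum_range_rpow_neg_le hs N
  have hpos : 0 ≤ 2 * π ^ (1 - s) := by positivity
  linarith [mul_le_mul_of_nonneg_left hS hpos]

/-! ## §3  The `d`-dimensional alias sum (4.22) -/

/-- The weight carried by the alias `p′ + 2πj` in (4.23): `Π_μ |p′_μ| |(p′ + 2πj)_μ|^{-1}` over the ACTIVE coordinates
(`j_μ ≠ 0`), `1` over the inactive ones — the product of (4.20) with the `|p′_μ|` of the coordinates where `l + m`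
vanishes cancelled against `|(p′+l+m)_μ|^{-1} = |p′_μ|^{-1}`. [cite: King1986, (4.20)–(4.23) p.672] -/
def aliasWeight {d : ℕ} (p : Fin d → ℝ) (j : Fin d → ℤ) : ℝ :=
  ∏ μ, if j μ = 0 then (1 : ℝ) else |p μ| / |p μ + 2 * π * j μ|

/-- The alias point `p′ + 2πj`. [cite: King1986, (4.2) p.670] -/
def aliasPt {d : ℕ} (p : Fin d → ℝ) (j : Fin d → ℤ) : Fin d → ℝ := fun μ => p μ + 2 * π * j μ

/-- The summand of (4.22) with the `|p′_μ|` factors of (4.20) included: `‖p′ + 2πj‖^{α−1} · aliasWeight p′ j`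
(sup norm; since `‖·‖_∞ ≤ |·|_2` and `α − 1 < 0`, this MAJORISES the Euclidean-norm summand).
[cite: King1986, (4.22) p.672] -/
def aliasTerm {d : ℕ} (α : ℝ) (p : Fin d → ℝ) (j : Fin d → ℤ) : ℝ :=
  ‖aliasPt p j‖ ^ (α - 1) * aliasWeight p j

/-- `aliasTerm` is nonnegative. [folklore] -/
theorem aliasTerm_nonneg {d : ℕ} (α : ℝ) (p : Fin d → ℝ) (j : Fin d → ℤ) : 0 ≤ aliasTerm α p j := by
  unfold aliasTerm aliasWeight
  refine mul_nonneg (rpow_nonneg (norm_nonneg _) _) (Finset.prod_nonneg fun μ _ => ?_)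
  split_ifs
  · exact zero_le_one
  · exact div_nonneg (abs_nonneg _) (abs_nonneg _)

/-- A nonzero alias is far from the origin: `‖p′ + 2πj‖ ≥ π ≥ 1` for `j ≠ 0`, `|p′_μ| ≤ π`. [folklore] -/
theorem one_le_norm_aliasPt {d : ℕ} {p : Fin d → ℝ} (hp : ∀ μ, |p μ| ≤ π) {j : Fin d → ℤ} (hj : j ≠ 0) :
    1 ≤ ‖aliasPt p j‖ := by
  obtain ⟨μ, hμ⟩ : ∃ μ, j μ ≠ 0 := by
    by_contra h
    exact hj (funext fun μ => by simpa using (not_exists.1 h) μ)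
  have h1 : π ≤ |p μ + 2 * π * j μ| := pi_le_abs_add (hp μ) hμ
  have h2 : ‖aliasPt p j μ‖ ≤ ‖aliasPt p j‖ := norm_le_pi_norm _ μ
  rw [Real.norm_eq_abs, show aliasPt p j μ = p μ + 2 * π * j μ from rfl] at h2
  linarith [Real.pi_gt_three]

/-- **Termwise factorisation** (King's "by inspection"): for `j ≠ 0`, `|p′_μ| ≤ π`, `α ≤ 1`, `d ≥ 1`,
`‖p′+2πj‖^{α−1}·aliasWeight ≤ Π_μ aliasMaj s p′_μ j_μ` with `s = 1 + (1 − α)/d`: write `‖q‖^{α−1} = Π_μ ‖q‖^{(α−1)/d}`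
and use `‖q‖ ≥ |q_μ|` on the active coordinates, `‖q‖ ≥ 1` on the inactive ones. [cite: King1986, (4.22) p.672] -/
theorem aliasTerm_le_prod_aliasMaj {d : ℕ} (hd : 0 < d) {α : ℝ} (hα : α ≤ 1) {p : Fin d → ℝ}
    (hp : ∀ μ, |p μ| ≤ π) {j : Fin d → ℤ} (hj : j ≠ 0) :
    aliasTerm α p j ≤ ∏ μ, aliasMaj (1 + (1 - α) / d) (p μ) (j μ) := by
  have hq1 : 1 ≤ ‖aliasPt p j‖ := one_le_norm_aliasPt hp hj
  have hq0 : 0 < ‖aliasPt p j‖ := by linarith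
  set e : ℝ := (α - 1) / d with he
  have he0 : e ≤ 0 := div_nonpos_of_nonpos_of_nonneg (by linarith) (Nat.cast_nonneg d)
  have hd' : (d : ℝ) ≠ 0 := by exact_mod_cast hd.ne'
  -- ‖q‖^{α-1} = ∏_μ ‖q‖^e
  have hsplit : ‖aliasPt p j‖ ^ (α - 1) = ∏ _μ : Fin d, ‖aliasPt p j‖ ^ e := by
    rw [Finset.prod_const, Finset.card_univ, Fintype.card_fin, ← rpow_mul_natCast hq0.le]
    congr 1
    rw [he]; field_simp
  unfold aliasTerm aliasWeight
  rw [hsplit, ← Finset.prod_mul_distrib]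
  refine Finset.prod_le_prod (fun μ _ => ?_) (fun μ _ => ?_)
  · refine mul_nonneg (rpow_nonneg hq0.le _) ?_
    split_ifs
    · exact zero_le_one
    · exact div_nonneg (abs_nonneg _) (abs_nonneg _)
  · unfold aliasMaj
    by_cases hμ : j μ = 0
    · rw [if_pos hμ, if_pos hμ, mul_one]
      exact rpow_le_one_of_one_le_of_nonpos hq1 he0
    · rw [if_neg hμ, if_neg hμ]
      have hqμ : π ≤ |p μ + 2 * π * j μ| := pi_le_abs_add (hp μ) hμ
      have hqμ0 : 0 < |p μ + 2 * π * j μ| := lt_of_lt_of_le Real.pi_pos hqμ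
      have hle : |p μ + 2 * π * j μ| ≤ ‖aliasPt p j‖ := by
        have := norm_le_pi_norm (aliasPt p j) μ
        rwa [Real.norm_eq_abs] at this
      -- ‖q‖^e ≤ |q_μ|^e
      have h1 : ‖aliasPt p j‖ ^ e ≤ |p μ + 2 * π * j μ| ^ e := rpow_le_rpow_of_nonpos hqμ0 hle he0
      have h2 : |p μ| / |p μ + 2 * π * ↑(j μ)| ≤ π / |p μ + 2 * π * ↑(j μ)| :=
        div_le_div_of_nonneg_right (hp μ) hqμ0.le
      calc ‖aliasPt p j‖ ^ e * (|p μ| / |p μ + 2 * π * ↑(j μ)|)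
          ≤ |p μ + 2 * π * j μ| ^ e * (π / |p μ + 2 * π * ↑(j μ)|) :=
            mul_le_mul h1 h2 (div_nonneg (abs_nonneg _) hqμ0.le) (rpow_nonneg hqμ0.le _)
        _ = π * |p μ + 2 * π * ↑(j μ)| ^ (-(1 + (1 - α) / ↑d)) := by
            have : -(1 + (1 - α) / (d : ℝ)) = e + (-1) := by rw [he]; field_simp; ring
            rw [this, rpow_add hqμ0, rpow_neg_one]
            ring

/-- The integer window `[-N, N]^d`. [folklore] -/
def aliasBox (d N : ℕ) : Finset (Fin d → ℤ) := Fintype.piFinset fun _ : Fin d => Finset.Icc (-(N : ℤ)) N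

/-- `0 ∈ aliasBox d N`. [folklore] -/
theorem zero_mem_aliasBox (d N : ℕ) : (0 : Fin d → ℤ) ∈ aliasBox d N := by
  unfold aliasBox
  rw [Fintype.mem_piFinset]
  intro μ
  simp

/-- The explicit constant of (4.22): `C(d, α) = (1 + 2π^{−(1−α)/d}·s/(s−1))^d − 1`, `s = 1 + (1−α)/d`
(so `s/(s−1) = 1 + d/(1−α)`). [cite: King1986, (4.22) p.672] -/
def aliasConst (d : ℕ) (α : ℝ) : ℝ :=
  (1 + 2 * π ^ (1 - (1 + (1 - α) / d)) * ((1 + (1 - α) / d) / ((1 + (1 - α) / d) - 1))) ^ d - 1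

/-- **King's alias-sum bound (4.22), kernel form with explicit constant**: for `d ≥ 1`, `α < 1`, `|p′_μ| ≤ π` and any
window `N`, `Σ_{j ∈ [-N,N]^d, j ≠ 0} ‖p′ + 2πj‖^{α−1}·Π_μ^{active}|p′_μ||(p′+2πj)_μ|^{-1} ≤ C(d, α)` uniformly in `p′` and
`N` — the sum over the box is the product of the one-coordinate sums (§2) minus the `j = 0` term.
[cite: King1986, (4.22) p.672] -/
theorem alias_sum_le {d : ℕ} (hd : 0 < d) {α : ℝ} (hα : α < 1) {p : Fin d → ℝ} (hp : ∀ μ, |p μ| ≤ π)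
    (N : ℕ) : ∑ j ∈ (aliasBox d N).erase 0, aliasTerm α p j ≤ aliasConst d α := by
  set s : ℝ := 1 + (1 - α) / d with hs_def
  have hs : 1 < s := by
    rw [hs_def]
    have : 0 < (1 - α) / (d : ℝ) := div_pos (by linarith) (by exact_mod_cast hd)
    linarith
  -- termwise majorisation
  have h1 : ∑ j ∈ (aliasBox d N).erase 0, aliasTerm α p j ≤
      ∑ j ∈ (aliasBox d N).erase 0, ∏ μ, aliasMaj s (p μ) (j μ) :=
    Finset.sum_le_sum fun j hj => aliasTerm_le_prod_aliasMaj hd hα.le hp (Finset.ne_of_mem_erase hj)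
  -- add back the j = 0 term (= 1) and factorise the box sum
  have h0 : ∏ μ : Fin d, aliasMaj s (p μ) ((0 : Fin d → ℤ) μ) = 1 := by simp [aliasMaj]
  have h2 : ∑ j ∈ (aliasBox d N).erase 0, ∏ μ, aliasMaj s (p μ) (j μ) =
      (∏ μ : Fin d, ∑ i ∈ Finset.Icc (-(N : ℤ)) N, aliasMaj s (p μ) i) - 1 := by
    have hz := zero_mem_aliasBox d N
    rw [Finset.prod_univ_sum]
    unfold aliasBox at hz ⊢
    rw [← Finset.add_sum_erase _ _ hz, h0]
    ring
  -- each one-coordinate sum ≤ 1 + K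
  have h3 : ∏ μ : Fin d, ∑ i ∈ Finset.Icc (-(N : ℤ)) N, aliasMaj s (p μ) i ≤
      (1 + 2 * π ^ (1 - s) * (s / (s - 1))) ^ d := by
    calc ∏ μ : Fin d, ∑ i ∈ Finset.Icc (-(N : ℤ)) N, aliasMaj s (p μ) i
        ≤ ∏ _μ : Fin d, (1 + 2 * π ^ (1 - s) * (s / (s - 1))) :=
          Finset.prod_le_prod (fun μ _ => Finset.sum_nonneg fun i _ => aliasMaj_nonneg _ _ _)
            (fun μ _ => sum_aliasMaj_le hs (hp μ) N)
      _ = (1 + 2 * π ^ (1 - s) * (s / (s - 1))) ^ d := by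
          rw [Finset.prod_const, Finset.card_univ, Fintype.card_fin]
  calc ∑ j ∈ (aliasBox d N).erase 0, aliasTerm α p j
      ≤ (∏ μ : Fin d, ∑ i ∈ Finset.Icc (-(N : ℤ)) N, aliasMaj s (p μ) i) - 1 := h1.trans_eq h2
    _ ≤ (1 + 2 * π ^ (1 - s) * (s / (s - 1))) ^ d - 1 := by linarith
    _ = aliasConst d α := by rw [aliasConst, hs_def]

/-- The same bound for any finite family of NONZERO integer vectors (every such family sits in a window, and the terms
are nonnegative) — the form in which (4.22) is used: the `(l, m) ≠ (0, 0)` part of King's double sum, `l ∈ 2πZ^d`,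
`|l_μ| ≤ π(L^k − 1)`, `m ∈ 2πL^kZ^d`, is a sum over DISTINCT nonzero aliases `p′ + l + m = p′ + 2πj`
(`digits_injective` below). [cite: King1986, (4.22)–(4.23) p.672] -/
theorem alias_sum_le_of_subset {d : ℕ} (hd : 0 < d) {α : ℝ} (hα : α < 1) {p : Fin d → ℝ}
    (hp : ∀ μ, |p μ| ≤ π) {Λ : Finset (Fin d → ℤ)} (h0 : (0 : Fin d → ℤ) ∉ Λ) :
    ∑ j ∈ Λ, aliasTerm α p j ≤ aliasConst d α := by
  classical
  -- a window containing Λ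
  obtain ⟨N, hN⟩ : ∃ N : ℕ, ∀ j ∈ Λ, ∀ μ, |j μ| ≤ N := by
    refine ⟨Λ.sup fun j => Finset.univ.sup fun μ => (j μ).natAbs, fun j hj μ => ?_⟩
    have h1 : (j μ).natAbs ≤ Finset.univ.sup fun μ => (j μ).natAbs :=
      Finset.le_sup (f := fun μ => (j μ).natAbs) (Finset.mem_univ μ)
    have h2 : (Finset.univ.sup fun μ => (j μ).natAbs) ≤ Λ.sup fun j => Finset.univ.sup fun μ => (j μ).natAbs :=
      Finset.le_sup (f := fun j => Finset.univ.sup fun μ => (j μ).natAbs) hj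
    have := h1.trans h2
    rw [← Int.natCast_natAbs]
    exact_mod_cast this
  have hsub : Λ ⊆ (aliasBox d N).erase 0 := by
    intro j hj
    rw [Finset.mem_erase]
    refine ⟨fun h => h0 (h ▸ hj), ?_⟩
    unfold aliasBox
    rw [Fintype.mem_piFinset]
    intro μ
    rw [Finset.mem_Icc]
    exact abs_le.1 (hN j hj μ)
  exact (Finset.sum_le_sum_of_subset_of_nonneg hsub fun j _ _ => aliasTerm_nonneg α p j).trans
    (alias_sum_le hd hα hp N)

/-! ## §4  King's `(l, m)` indexation: `l + m` runs over distinct aliases -/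

/-- One coordinate of King's double index: `a + M·b` with `|a|, |a′| ≤ (M − 1)/2` (i.e. `2|a| < M`) determines `a`
and `b` — the `(l, m) ↦ l + m` map of (4.19) (`l = 2πa`, `|l_μ| ≤ π(L^k − 1)`; `m = 2πL^k b`) is injective, so the
double sum in (4.22)/(4.23) is a sum over distinct aliases. [cite: King1986, (4.19) p.672] -/
theorem digits_injective {M a a' b b' : ℤ} (ha : 2 * |a| < M) (ha' : 2 * |a'| < M)
    (h : a + M * b = a' + M * b') : a = a' ∧ b = b' := by
  have hM : 0 < M := by have := abs_nonneg a; omega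
  have hdiv : M ∣ (a - a') := ⟨b' - b, by linarith⟩
  have hsmall : |a - a'| < M := by
    have := abs_sub a a'
    omega
  have haa : a = a' := by
    rcases hdiv with ⟨c, hc⟩
    have hc0 : c = 0 := by
      by_contra hne
      have : M ≤ |a - a'| := by
        rw [hc, abs_mul, abs_of_pos hM]
        have : 1 ≤ |c| := Int.one_le_abs hne
        nlinarith
      omega
    rw [hc0, mul_zero] at hc
    omega
  refine ⟨haa, ?_⟩
  subst haa
  have : M * b = M * b' := by linarith
  exact mul_left_cancel₀ hM.ne' this

/-- The `d`-dimensional form: `(a, b) ↦ a + M b` is injective on `{2|a_μ| < M ∀μ} × Z^d`.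
[cite: King1986, (4.19) p.672] -/
theorem digits_injective_pi {d : ℕ} {M : ℤ} {a a' b b' : Fin d → ℤ} (ha : ∀ μ, 2 * |a μ| < M)
    (ha' : ∀ μ, 2 * |a' μ| < M) (h : a + M • b = a' + M • b') : a = a' ∧ b = b' := by
  have hμ : ∀ μ, a μ = a' μ ∧ b μ = b' μ := fun μ => by
    have := congr_fun h μ
    simp only [Pi.add_apply, Pi.smul_apply, smul_eq_mul] at this
    exact digits_injective (ha μ) (ha' μ) this
  exact ⟨funext fun μ => (hμ μ).1, funext fun μ => (hμ μ).2⟩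

end Literature.MathematicalPhysics.QuantumFieldTheory.King1986

end
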